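import Literature.IUT.HodgeArakelov.ThetaEnvDataRecordAutSaturated
import Literature.IUT.HodgeArakelov.ThetaEnvDataRecordAutOfKummer

/-!
# [IUTchII] Prop 3.4 (i) at the GENUINE data, SATURATED index set, genuine Kummer map: residual = {F-0620, `hq`,
# `hroot`, `hsemi`} — abc-iut-w6-d002's saturated theorem with abc-iut-w5-d169's (P3)/(P4) reductions

S. Mochizuki, *Inter-universal Teichmüller theory II*, kurims manuscript (Dec. 2020): Prop 3.4 (i) pp. 91–92
[cite: Mochizuki2012, Prop 3.4 (i) p.91]; Prop 3.1 (i) p. 87 («[ι ranges] over the inversion automorphisms of Proposition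
2.2, (i)»); Prop 1.4 p. 27; Prop 3.1 (ii) p. 88.  Claim key DISPUTED (D-0012).  [EtTh] (refereed): Cor. 2.18 (i) p. 60 (=
F-0620, BY NAME), Cor. 2.19 (iii) p. 65; [AbsTopIII] Prop. 3.2 p. 71.  abc-iut cell, layer L6, WAVE-5 seat abc-iut-w5-d169
(holder of `plan/L6/SUBDAG-IUTchII-Prop-31-33-34.md`, sub-row «P34i-GENUINE-(P1)»); GAP rows G-w5d169-2, G-w5d169-3.

PROOF-ONLY two-line corollary (no definitions, no `Prop`-valued fact) combining abc-iut-w6-d002's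
`EtaleLevels.prop34i_multiradiallyDefined_saturated` (p432926: `ι` ranging over the `Aut_top(Π^tp_X̲̲)`-SATURATED orbit of
`ρ_{ι₀}`, so that binder (P2) / G-w5d169-1 is not needed) with abc-iut-w5-d169's reductions of the remaining binders:
(P4) `hθ`/`hinf` ⟸ `hroot` (`image_toLim_theta_thetaEnvData_of_rootHyp` / `image_thetaInfty_thetaEnvData_of_rootHyp`,
p432788 — [EtTh] Cor. 2.19 (iii) read at `Π^tp_X̲̲`, G-w5d169-2) and (P3) `hκ` ⟸ `hsemi` at abc-iut-w4-d007's GENUINE Kummer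
map `κ := h1LimKummerOn c O` (`map_mrange_h1LimKummerOn_eq_of_semilinear`, p433365 — [AbsTopIII] Prop. 3.2 functoriality,
G-w5d169-3).
* **`EtaleLevels.prop34i_multiradiallyDefined_saturated_ofKummer`** — [IUTchII] Prop 3.4 (i) multiradiality AT THE GENUINE
  FUNCTOR, saturated index set, genuine Kummer map; residual BY NAME exactly: F-0620 (FACT) · `hq` · `hroot` · `hsemi` ·
  the standing record/Kummer inputs (`mods`, `hmods`, `h15`, `L`, `hZ`, `hcharY`, `hlim`; `c`, `hopen`, `hfi`).
Nothing here asserts anything of [IUTchII]; no side taken on [IUTchIII] Cor 3.12; typed ≠ proved.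
-/

noncomputable section

open Topology

namespace Literature.IUT.HodgeArakelov

open Literature.AnabelianGeometry.EtaleTheta Literature.AnabelianGeometry.SemiGraphs
open CohomologySystemOfContH1 EtaleThetaDataOfSetting TemperedThetaMonoids
open scoped Literature.AnabelianGeometry.EtaleTheta

namespace EtaleLevels

variable {p : ℕ} [Fact p.Prime] {D : Literature.AnabelianGeometry.EtaleTheta.ThetaSetting p}
  {E : D.EtaleThetaData} {l : ℕ} (C : E.DoubleUnderline l) (hC : D.Compat) (hS : D.Sec2Hyps)
  (hl : l.Prime) (hp2 : p ≠ 2) (hpl : p ≠ l) (hζ : ∃ ζ : D.K, IsPrimitiveRoot ζ (4 * l))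
  (mods : ∀ M : ℕ+, D.CyclotomeMod l M)
  (f : contCocycles D.toTheta D.DeltaTheta C.GtpYdduu) (hf : f ∈ C.rootCocycles hC)
  (hmods : ∀ (M M' : ℕ+) (h : (M : ℕ) ∣ (M' : ℕ)) (x : D.lDeltaTheta l),
    MuN.red p M M' h ((mods M').red x) = (mods M).red x)
  (h15 : Literature.AnabelianGeometry.EtaleTheta.ThetaSetting.Prop15iii E hC) (L : C.CuspLabels)
  (hZ : ∀ M : ℕ+, Nonempty (ModelCyclotomes.lDeltaQuot (C.rigidData (mods M) hC hS h15 L) ≃*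
    Literature.IUT.HodgeTheaters.ZHat))
  (hcharY : EtaleThetaDataOfSetting.PiYddCharacteristic C)
  (hlim : Function.Bijective (rigidLimHom C hC hS hl hp2 hpl hζ mods f hf hmods h15 L hZ))
  [(EtaleThetaDataOfSetting.PiYdd C).Normal]
  (hq : IsQuotientMap D.toTheta) {N : ℕ+} (μ : D.CyclotomeMod l N)
  (R : RigidData.{0} N l) (hR : R = C.rigidData μ hC hS h15 L) (h218i : R.Cor218_i)
  (hroot : ∀ α : (Pi C) ≃ₜ* (Pi C), ∃ τ : Pi C, ∃ ε : (coh C).H1 ⊤, l • ε = 0 ∧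
    autActTopOfCor218i C hq μ hC hS h15 L R hR h218i α (rootTop C) =
      h1TopConjEquiv (phi C) (D.lDeltaTheta l) (PiYdd C) τ (rootTop C) + ε)
  (ι₀ : (Pi C) ≃ₜ* (Pi C))
  {A : Type} [CommGroup A] [MulDistribMulAction (Pi C) A] [TopologicalSpace A] [RootableBy A ℕ]
  (cyc : CyclotomeCoefficients (phi C) (D.lDeltaTheta l) A)
  (hopen : ∀ b : A, IsOpen (MulAction.stabilizer (Pi C) b : Set (Pi C)))
  (hfi : ∀ b : A, (MulAction.stabilizer (Pi C) b).FiniteIndex) (O : Submonoid A)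
  (hsemi : ∀ α : (Pi C) ≃ₜ* (Pi C), ∃ e : A ≃* A,
    (∀ (x : Pi C) (a : A), x • e a = e (α.symm x • a)) ∧
    (∀ ζ : cyclotome A, ((cyc.hom (cyclotome.map e.toMonoidHom ζ) : D.lDeltaTheta l) : D.GtpTheta) =
      ((rangeAutOfCor218i C μ hq hC hS h15 L R hR h218i α
        ⟨(cyc.hom ζ : D.GtpTheta), lDeltaTheta_le_phiRange C (cyc.hom ζ).2⟩ : phiRange C) : D.GtpTheta)) ∧
    (∀ a, a ∈ O ↔ e a ∈ O))

/-- **[IUTchII] Prop 3.4 (i) — MULTIRADIALITY OF SPLIT THETA MONOIDS AT THE GENUINE FUNCTOR, `ι` over the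
`Aut_top(Π^tp_X̲̲)`-SATURATED orbit of `ρ_{ι₀}` (abc-iut-w6-d002), genuine constant-monoid Kummer map `κ = h1LimKummerOn c O`
(abc-iut-w4-d007)**: (P1) := {F-0620, `hq`}; (P2) not needed; (P3) := `hsemi`; (P4) := `hroot`.
[cite: Mochizuki2012, Prop 3.4 (i) p.92] -/
theorem prop34i_multiradiallyDefined_saturated_ofKummer
    {η : (C.thetaEnvData μ hC hS).PiYdd → MuN p N} (hη : η ∈ (C.thetaEnvData μ hC hS).thetaCocycles)
    (Γ : Type) [Group Γ] :
    ((ex18iii (ThetaSetting.ofDoubleUnderline C μ hC hS hl hp2 hpl hζ hη) Γ).toDagger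
      (TemperedThetaMonoids.prop34iRadialFunctor
        (thetaEnvTransportS C hC hS hl hp2 hpl hζ mods f hf hmods h15 L hZ hcharY hlim hq μ R hR h218i
          (h1LimKummerOn (phi C) (D.lDeltaTheta l) (PiYdd C) cyc hopen hfi O) ι₀
          (map_mrange_h1LimKummerOn_eq_of_semilinear C hq cyc hopen hfi μ hC hS h15 L R hR h218i O hsemi)
          (image_toLim_theta_thetaEnvData_of_rootHyp C hC hS hl hp2 hpl hζ mods f hf hmods h15 L hZ hcharY hlim hq
            μ R hR h218i hroot)
          (image_thetaInfty_thetaEnvData_of_rootHyp C hC hS hl hp2 hpl hζ mods f hf hmods h15 L hZ hcharY hlim hq μ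
            R hR h218i hroot) hη)
        Γ)).IsMultiradiallyDefined :=
  prop34i_multiradiallyDefined_saturated C hC hS hl hp2 hpl hζ mods f hf hmods h15 L hZ hcharY hlim hq μ R hR h218i _ ι₀
    _ _ _ hη Γ

end EtaleLevels

end Literature.IUT.HodgeArakelov

end
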